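import Literature.NumberTheory.GelbartRogawski1991.UnitaryDualPairThetaLiftGaussianCharacter
import HarnessLib

-- As in the lineage (`UnitaryDualPairThetaKernelGaussian`, `…ThetaLiftGaussianCMLine`, `…ThetaLiftGaussianCharacter`;
-- ops-buildfix G11b-3): statements over the theta-kernel datum elaborate to very large types; elaborate sequentially.
set_option Elab.async false

/-!
# Theta-related pairs of automorphic characters for a dual pair with two compact abelian members

Topic `NumberTheory/GelbartRogawski1991`; namespaces `Literature.NumberTheory.Weil1964.ThetaKernelDatum` (§0, generic)
and `Literature.NumberTheory.GelbartRogawski1991.UnitaryDualPair` (§1, the pair `U(⟨1⟩) × U(⟨1⟩)` over a CM field).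
Continues `UnitaryDualPairThetaLiftGaussianCharacter` (§4 there: for `U(⟨1⟩) × U(⟨1⟩)` over every CM field some
automorphic character `χ` of `[U(⟨1⟩)]` has `Θ_{Φ_G}(χ)(1̄) ≠ 0`, modulo `hGR`).  KERNEL file: THEOREMS ONLY (no
definition, no instance, no named fact, no `sorry`).

When BOTH members `GU ⧸ ΓU` and `G ⧸ Γ` of a dual-pair theta datum are compact Hausdorff ABELIAN groups, the theta
kernel `θ_Φ` pairs automorphic characters `ψ` of the first with automorphic characters `χ` of the second through the
**theta pairing** `∫ Θ^{μ}_Φ(χ)(ξ) ψ(ξ) dν(ξ) = ∫∫ θ_Φ(ξ, q) χ(q) ψ(ξ) dμ(q) dν(ξ)` — the `ψ̄`-th Fourier coefficient of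
the theta lift of `χ` [FleigEtAl2018, (12.37)]:

* §0.1 `integral_thetaLift_charCM_mul_charCM_eq` — the pairing is SYMMETRIC in the two lifts:
  `∫ Θ_Φ(χ) · ψ dν = ∫ χ · Θᵗ_Φ(ψ) dμ` (adjointness of (12.37)/(12.38), tree `integral_thetaLift_mul`);
* §0.2 `exists_character_pair_integral_thetaLift_charCM_ne_zero` — **if `θ_Φ ≢ 0` then some pair `(χ, ψ)` is
  theta-related**: `∫ Θ_Φ(χ) · ψ dν ≠ 0` (`μ`, `ν` finite Borel measures charging open sets) — the Pontryagin–van Kampen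
  theorem (tree `exists_integral_mul_character_ne_zero`) applied twice, once on each member;
* §1 `cmThetaKernelDatum_U1U1_exists_character_pair_integral_thetaLift_gaussSB_ne_zero` — **`U(⟨1⟩) × U(⟨1⟩)` OVER
  EVERY CM FIELD `L`, MODULO [GelbartRogawski1991, Prop. 3.1.1] (`hGR`) ONLY: there are automorphic characters `χ`, `ψ`
  of the compact abelian group `[U(⟨1⟩)] = U(⟨1⟩)(𝔸_{L⁺}) ⧸ U(⟨1⟩)(L⁺)` which are theta-related at the Gaussian level**,
  `∫ Θ^{Haar}_{Φ_G}(χ)(ξ) ψ(ξ) dν(ξ) ≠ 0` for every finite Borel measure `ν` charging open sets — the character-to-character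
  theta correspondence between the two `U(1)`'s built from Prop. 3.1.1 alone has a non-zero matrix coefficient.

## References
* P. Fleig, H. P. A. Gustafsson, A. Kleinschmidt, D. Persson, *Eisenstein Series and Automorphic Representations* (2018),
  §12.3 Definition 12.5 (12.37)–(12.38), printed p. 296 [FleigEtAl2018].
* S. Gelbart, J. Rogawski, *L-functions and Fourier–Jacobi coefficients for the unitary group U(3)*, Invent. Math. 105
  (1991), §3.1 Prop. 3.1.1 p. 455, §3.2 p. 457 [GelbartRogawski1991].
* A. Deitmar, S. Echterhoff, *Principles of Harmonic Analysis*, 2nd ed. (2014), Prop. 3.5.2 [DeitmarEchterhoff2014].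

## Provenance
Lane `lit-hodgefound` (HOME `run/shared/lean/pub/lit-hodgefound/`), prover seat `lit-hodgefound-p05` generation 5, seventh
row.
-/

set_option autoImplicit false

noncomputable section

open scoped Matrix ComplexConjugate ComplexOrder
open NumberField NumberField.mixedEmbedding IsDedekindDomain
open _root_.MeasureTheory
open Literature.NumberTheory.Automorphic
open Literature.AlgebraicGeometry.ShimuraVarieties (hermForm)
open Literature.RepresentationTheory.CompactGroups

/-! ## §0. Generic: both members compact abelian -/

namespace Literature.NumberTheory.Weil1964.ThetaKernelDatum

variable {Mp : Type*} {SX : Type*} [TopologicalSpace Mp] [Group Mp] [TopologicalSpace SX]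
variable {GU : Type*} [CommGroup GU] [TopologicalSpace GU] [IsTopologicalGroup GU] {ΓU : Subgroup GU}
variable {G : Type*} [CommGroup G] [TopologicalSpace G] [IsTopologicalGroup G] {Γ : Subgroup G}
variable (M : ThetaKernelDatum Mp SX GU ΓU G Γ)
variable [CompactSpace (GU ⧸ ΓU)] [CompactSpace (G ⧸ Γ)]
  [MeasurableSpace (G ⧸ Γ)] [BorelSpace (G ⧸ Γ)] (μ : Measure (G ⧸ Γ)) [IsFiniteMeasure μ]
  [MeasurableSpace (GU ⧸ ΓU)] [BorelSpace (GU ⧸ ΓU)] (ν : Measure (GU ⧸ ΓU)) [IsFiniteMeasure ν]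

/-- **The theta pairing of a pair of automorphic characters is symmetric in the two lifts**: for characters `χ` of
`G ⧸ Γ` and `ψ` of `GU ⧸ ΓU`, `∫ Θ^{μ}_Φ(χ)(ξ) ψ(ξ) dν(ξ) = ∫ χ(q) Θᵗ^{ν}_Φ(ψ)(q) dμ(q)` — both equal the double
integral of `θ_Φ(ξ, q) χ(q) ψ(ξ)` (adjointness of the lifts (12.37) and (12.38)).
[cite: FleigEtAl2018, §12.3 Definition 12.5 (12.37)–(12.38), p. 296] -/
theorem integral_thetaLift_charCM_mul_charCM_eq (Φ : SX) (χ : PontryaginDual (G ⧸ Γ)) (ψ : PontryaginDual (GU ⧸ ΓU)) :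
    ∫ ξ, M.thetaLift μ Φ (charCM χ) ξ * charCM ψ ξ ∂ν = ∫ q, charCM χ q * M.thetaLiftT ν Φ (charCM ψ) q ∂μ :=
  M.integral_thetaLift_mul ν μ Φ (charCM χ) (charCM ψ)

variable [T2Space (GU ⧸ ΓU)] [T2Space (G ⧸ Γ)] [μ.IsOpenPosMeasure] [ν.IsOpenPosMeasure]

/-- **If the theta kernel is not identically zero, some pair of automorphic characters is theta-related.**  For a
dual-pair theta datum both of whose members `GU ⧸ ΓU`, `G ⧸ Γ` are compact Hausdorff abelian groups, finite Borel
measures `μ`, `ν` charging open sets, and a Schwartz vector `Φ` with `θ_Φ(ξ₀, q₀) ≠ 0` somewhere: there are continuous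
unitary characters `χ` of `G ⧸ Γ` and `ψ` of `GU ⧸ ΓU` with `∫ Θ^{μ}_Φ(χ)(ξ) ψ(ξ) dν(ξ) ≠ 0` — Pontryagin–van Kampen
on the second member gives `χ` with `Θ_Φ(χ) ≠ 0` (`exists_character_thetaLift_ne_zero_fun`), and on the first member a
non-zero Fourier coefficient of the continuous function `Θ_Φ(χ)`.
[cite: FleigEtAl2018, §12.3 Definition 12.5 (12.37), p. 296; DeitmarEchterhoff2014, Prop. 3.5.2] -/
theorem exists_character_pair_integral_thetaLift_charCM_ne_zero {Φ : SX}
    (hne : ∃ (ξ₀ : GU ⧸ ΓU) (q₀ : G ⧸ Γ), M.thetaKer Φ (ξ₀, q₀) ≠ 0) :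
    ∃ (χ : PontryaginDual (G ⧸ Γ)) (ψ : PontryaginDual (GU ⧸ ΓU)),
      ∫ ξ, M.thetaLift μ Φ (charCM χ) ξ * charCM ψ ξ ∂ν ≠ 0 := by
  obtain ⟨ξ₀, q₀, h0⟩ := hne
  obtain ⟨χ, hχ⟩ := M.exists_character_thetaLift_ne_zero_fun μ (ξ₀ := ξ₀) ⟨q₀, h0⟩
  obtain ⟨ψ, hψ⟩ := exists_integral_mul_character_ne_zero ν (M.thetaLift μ Φ (charCM χ)) hχ
  exact ⟨χ, ψ, by simpa only [charCM_apply] using hψ⟩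

/-- … and then, symmetrically, `χ` OCCURS in the opposite lift of `ψ`: `∫ χ(q) Θᵗ^{ν}_Φ(ψ)(q) dμ(q) ≠ 0` for the same
pair. [cite: FleigEtAl2018, §12.3 Definition 12.5 (12.37)–(12.38), p. 296; DeitmarEchterhoff2014, Prop. 3.5.2] -/
theorem exists_character_pair_integral_charCM_mul_thetaLiftT_ne_zero {Φ : SX}
    (hne : ∃ (ξ₀ : GU ⧸ ΓU) (q₀ : G ⧸ Γ), M.thetaKer Φ (ξ₀, q₀) ≠ 0) :
    ∃ (χ : PontryaginDual (G ⧸ Γ)) (ψ : PontryaginDual (GU ⧸ ΓU)),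
      ∫ q, charCM χ q * M.thetaLiftT ν Φ (charCM ψ) q ∂μ ≠ 0 := by
  obtain ⟨χ, ψ, h⟩ := M.exists_character_pair_integral_thetaLift_charCM_ne_zero μ ν hne
  exact ⟨χ, ψ, by rwa [M.integral_thetaLift_charCM_mul_charCM_eq μ ν] at h⟩

end Literature.NumberTheory.Weil1964.ThetaKernelDatum

/-! ## §1. `U(⟨1⟩) × U(⟨1⟩)` over a CM field -/

namespace Literature.NumberTheory.GelbartRogawski1991

namespace UnitaryDualPair

open Literature.NumberTheory.Weil1964

section U1U1

variable (L : Type) [Field L] [NumberField L] [IsCMField L]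

/-- `U(⟨d⟩)(𝔸_{L⁺}) ⊂ GL₁(𝔸_L)` is commutative (`1 × 1` matrices over a commutative ring). [folklore] -/
private theorem adelic_line_mul_comm (d : Fin 1 → L)
    (a b : ↥(UnitaryGroup.adelic ↥(maximalRealSubfield L) L (IsCMField.complexConj L) 1 (Matrix.diagonal d))) :
    a * b = b * a := by
  apply Subtype.ext
  show (a : GL (Fin 1) (AdeleRing (𝓞 L) L)) * b = b * a
  ext i j
  simp [Units.val_mul, Matrix.mul_apply, Subsingleton.elim i 0, Subsingleton.elim j 0, mul_comm]

/-- The rational points `U(⟨d⟩)(L⁺)` form a NORMAL subgroup of the commutative group `U(⟨d⟩)(𝔸_{L⁺})`. [folklore] -/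
private theorem normal_range_toAdelic_line (d : Fin 1 → L) :
    (UnitaryGroup.toAdelic ↥(maximalRealSubfield L) L (IsCMField.complexConj L) 1 (Matrix.diagonal d)).range.Normal :=
  ⟨fun m hm g => by rwa [adelic_line_mul_comm L d g m, mul_inv_cancel_right]⟩

/-- `1̄ = 1` in the CM field (the hermitian line `⟨1⟩`). [folklore] -/
private theorem complexConj_one_vec : ∀ i : Fin 1, IsCMField.complexConj L ((1 : Fin 1 → L) i) = (1 : Fin 1 → L) i :=
  fun i => by rw [Pi.one_apply, map_one]

omit [NumberField L] [IsCMField L] in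
/-- `1 ≠ 0` coordinatewise (the hermitian line `⟨1⟩` is non-degenerate). [folklore] -/
private theorem one_vec_ne_zero : ∀ i : Fin 1, (1 : Fin 1 → L) i ≠ 0 := fun i => by
  rw [Pi.one_apply]; exact one_ne_zero

omit [NumberField L] [IsCMField L] in
/-- `re τ(1) = 1 > 0` through every complex embedding. [folklore] -/
private theorem re_apply_one_vec_pos (τ : L →+* ℂ) (j : Fin 1) : 0 < (τ ((1 : Fin 1 → L) j)).re := by
  rw [Pi.one_apply, map_one, Complex.one_re]
  exact one_pos

/-- **`U(⟨1⟩) × U(⟨1⟩)` OVER EVERY CM FIELD: A THETA-RELATED PAIR OF AUTOMORPHIC CHARACTERS, modulo `hGR` only.**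
For every CM field `L`, every complex embedding `ι`, the compatible splitting `hGR` of [GelbartRogawski1991,
Prop. 3.1.1] for the pair `(U(⟨1⟩), U(⟨1⟩))`, and every finite Borel measure `ν` on the compact abelian group
`[U(⟨1⟩)] = U(⟨1⟩)(𝔸_{L⁺}) ⧸ U(⟨1⟩)(L⁺)` charging open sets: there are continuous unitary characters `χ`, `ψ` of
`[U(⟨1⟩)]` with `∫ Θ^{Haar}_{Φ_G}(χ)(ξ) · ψ(ξ) dν(ξ) ≠ 0` — the `ψ̄`-th Fourier coefficient of the Haar theta lift
of `χ` at the Gaussian level is non-zero (the character `χ` with `Θ_{Φ_G}(χ) ≠ 0` of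
`cmThetaKernelDatum_line_exists_character_thetaLift_gaussSB_haar_ne_zero_fun` at `N = 1`, `d_V = d_W = 1`, then
Pontryagin–van Kampen on the first member).  Borel σ-algebra, group structure and Haar measure of the second member fixed in the statement.
[cite: GelbartRogawski1991, §3.2 p. 457; FleigEtAl2018, §12.3 Definition 12.5 (12.37), p. 296; DeitmarEchterhoff2014,
Prop. 3.5.2] -/
theorem cmThetaKernelDatum_U1U1_exists_character_pair_integral_thetaLift_gaussSB_ne_zero (e : Fin 1 × Fin 1 ≃ Fin 1)
    (ι : L →+* ℂ)
    (hGR : (cmSplittingDatum L e 1 (complexConj_one_vec L) (one_vec_ne_zero L) 1 (complexConj_one_vec L)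
      (one_vec_ne_zero L)).CompatibleSplitting) :
    haveI := normal_range_toAdelic_line L 1
    letI : MeasurableSpace (↥(UnitaryGroup.adelic ↥(maximalRealSubfield L) L (IsCMField.complexConj L) 1
        (Matrix.diagonal 1)) ⧸ (UnitaryGroup.toAdelic ↥(maximalRealSubfield L) L (IsCMField.complexConj L) 1
        (Matrix.diagonal 1)).range) := borel _
    haveI : BorelSpace (↥(UnitaryGroup.adelic ↥(maximalRealSubfield L) L (IsCMField.complexConj L) 1
        (Matrix.diagonal 1)) ⧸ (UnitaryGroup.toAdelic ↥(maximalRealSubfield L) L (IsCMField.complexConj L) 1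
        (Matrix.diagonal 1)).range) := ⟨rfl⟩
    haveI : CompactSpace (↥(UnitaryGroup.adelic ↥(maximalRealSubfield L) L (IsCMField.complexConj L) 1
        (Matrix.diagonal 1)) ⧸ (UnitaryGroup.toAdelic ↥(maximalRealSubfield L) L (IsCMField.complexConj L) 1
        (Matrix.diagonal 1)).range) := compactSpace_quotient_range_toAdelic_line L 1 (complexConj_one_vec L) (one_vec_ne_zero L)
    ∀ (ν : Measure (↥(UnitaryGroup.adelic ↥(maximalRealSubfield L) L (IsCMField.complexConj L) 1 (Matrix.diagonal 1)) ⧸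
        (UnitaryGroup.toAdelic ↥(maximalRealSubfield L) L (IsCMField.complexConj L) 1 (Matrix.diagonal 1)).range))
      [IsFiniteMeasure ν] [ν.IsOpenPosMeasure],
      ∃ χ ψ : PontryaginDual (↥(UnitaryGroup.adelic ↥(maximalRealSubfield L) L (IsCMField.complexConj L) 1
          (Matrix.diagonal 1)) ⧸ (UnitaryGroup.toAdelic ↥(maximalRealSubfield L) L (IsCMField.complexConj L) 1
          (Matrix.diagonal 1)).range),
        ∫ ξ, (cmThetaKernelDatum L e 1 (complexConj_one_vec L) (one_vec_ne_zero L) 1 (complexConj_one_vec L)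
            (one_vec_ne_zero L) hGR
            (hasThetaMajorants_cmPairSplitting_of_signs_one L e 1 (complexConj_one_vec L) (one_vec_ne_zero L) 1
              (complexConj_one_vec L) (one_vec_ne_zero L) ι hGR
              ⟨0, Or.inl fun i hi => absurd (Subsingleton.elim i 0) hi⟩ (fun τ _ => Or.inl (re_apply_one_vec_pos L τ)))
            Set.univ (fun _ _ _ => Set.mem_univ _)).thetaLift Measure.haar (gaussSB ↥(maximalRealSubfield L) 1)
            (charCM χ) ξ * charCM ψ ξ ∂ν ≠ 0 := by
  haveI := normal_range_toAdelic_line L 1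
  letI : MeasurableSpace (↥(UnitaryGroup.adelic ↥(maximalRealSubfield L) L (IsCMField.complexConj L) 1
      (Matrix.diagonal 1)) ⧸ (UnitaryGroup.toAdelic ↥(maximalRealSubfield L) L (IsCMField.complexConj L) 1
      (Matrix.diagonal 1)).range) := borel _
  haveI : BorelSpace (↥(UnitaryGroup.adelic ↥(maximalRealSubfield L) L (IsCMField.complexConj L) 1
      (Matrix.diagonal 1)) ⧸ (UnitaryGroup.toAdelic ↥(maximalRealSubfield L) L (IsCMField.complexConj L) 1
      (Matrix.diagonal 1)).range) := ⟨rfl⟩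
  haveI : CompactSpace (↥(UnitaryGroup.adelic ↥(maximalRealSubfield L) L (IsCMField.complexConj L) 1
      (Matrix.diagonal 1)) ⧸ (UnitaryGroup.toAdelic ↥(maximalRealSubfield L) L (IsCMField.complexConj L) 1
      (Matrix.diagonal 1)).range) := compactSpace_quotient_range_toAdelic_line L 1 (complexConj_one_vec L) (one_vec_ne_zero L)
  intro ν _ _
  letI : CommGroup ↥(UnitaryGroup.adelic ↥(maximalRealSubfield L) L (IsCMField.complexConj L) 1 (Matrix.diagonal 1)) :=
    { (inferInstance : Group ↥(UnitaryGroup.adelic ↥(maximalRealSubfield L) L (IsCMField.complexConj L) 1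
        (Matrix.diagonal 1))) with
      mul_comm := adelic_line_mul_comm L 1 }
  haveI : T2Space (↥(UnitaryGroup.adelic ↥(maximalRealSubfield L) L (IsCMField.complexConj L) 1 (Matrix.diagonal 1)) ⧸
      (UnitaryGroup.toAdelic ↥(maximalRealSubfield L) L (IsCMField.complexConj L) 1 (Matrix.diagonal 1)).range) :=
    t2Space_quotient_range_toAdelic L 1 (Matrix.diagonal 1)
  -- the character with non-zero Haar theta lift, from `…ThetaLiftGaussianCharacter` §2 at `N = 1`, `d_V = d_W = 1`
  -- (the public, witness-parametric form, so that the theta-kernel datum is literally the one of the statement)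
  obtain ⟨χ, hne⟩ := cmThetaKernelDatum_line_exists_character_thetaLift_gaussSB_haar_ne_zero_fun L e 1
    (complexConj_one_vec L) (one_vec_ne_zero L) 1 (complexConj_one_vec L) (one_vec_ne_zero L) ι hGR
    ⟨0, Or.inl fun i hi => absurd (Subsingleton.elim i 0) hi⟩ (fun τ _ => Or.inl (re_apply_one_vec_pos L τ))
  -- `charCM ψ ξ = ↑(ψ ξ)` definitionally (`charCM_apply` is `rfl`); no `simp` through the theta-kernel datum
  obtain ⟨ψ, hψ⟩ := exists_integral_mul_character_ne_zero ν _ hne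
  exact ⟨χ, ψ, hψ⟩

end U1U1

/-! ### Build-lane note
As in the lineage (ops-buildfix G11b-3): the public theorem whose statement unfolds to the theta-kernel data is tagged
`[implicit_reducible]` only to keep it out of the library-suggestion index computed at `.olean` export. -/
set_option allowUnsafeReducibility true in
attribute [implicit_reducible]
  cmThetaKernelDatum_U1U1_exists_character_pair_integral_thetaLift_gaussSB_ne_zero

end UnitaryDualPair

end Literature.NumberTheory.GelbartRogawski1991

end
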